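import Summits.BirchSwinnertonDyer.BirchSwinnertonDyer.Theorems.ClassRecordThreeEulerHalvesAtThreeCartanSupplyCubicPointsFixedRoots
import Summits.BirchSwinnertonDyer.BirchSwinnertonDyer.Theorems.ClassRecordThreeEulerHalvesAtThreeCartanTorusCubeCutSteinbergSimple
import HarnessLib

/-!
# The cubic classes `X = (𝔽_q² ∖ 0)/K`: a concrete model of the cubic points `GL₂(𝔽_q) ∕ H_cubic`

Helper file `--supports stmt-BirchSwinnertonDyer-23422` (seat `bsd-stepL-tam3-p1` g23, LINE OWNER of crux 23422 `EulerHalvesAtThreeResidualUpperBound`,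
line `cartan` v11), serving the registered stub (SUPPLY) `stub_cartanTorusLatticeSupply : CartanCorrespondence.CartanTorusLatticeSupply`
(memo `HOME/tam3-p1/g23/SUPPLY-ROAD-GG1.md` §2, re-modelled): the `GL₂(𝔽_q)`-set of CUBIC CLASSES of non-zero vectors,
`X = V₀ ∕ K` (`V₀ = 𝔽_q² ∖ 0`, `K ⊂ 𝔽_q^×` the cubes, `cubes q`), with the TWISTED action `g ⋆ [v] = [det g · g v]` (`actV`, `σV`, `σX`;
the stabiliser of `[e₀]` is the cubic Borel subgroup `{c = 0, a/d ∈ K}` of `…CubicPoints`), the commuting UNIT SCALINGS `ρ_u [v] = [u v]`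
(`scaleV`, `ρX`, `σX_ρX_comm`; `ρ_k = 1` for `k ∈ K`), and the equivariant projection `toP1 : X → ℙ¹(𝔽_q)`, `[v] ↦ [v]`
(`toP1_σX`, `toP1_ρX`, `toP1_surjective`, fibres = unit-scaling orbits `toP1_eq_toP1_iff`). Fixed points:
`σX g [v] = [v] ⟺ g v = a v ∧ ∃ u, u³ det g = a²` (`σX_mk_eq_mk_iff`) — the eigenvector-with-cube-condition count `E(g)` of
`…CubicPointsFixed*`; every class has exactly `#K` members (`card_fibre_mk`), so `#Fix(g | X) · #K = E(g)` (`card_fixed_mul_card_cubes`).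
HONEST FRAMING: finite-field bookkeeping; nothing about SUPPLY, NUM, crux 23422 ∕ 19109 is proved here; BSD is proved for no curve. [folklore]
-/

namespace Summit.BirchSwinnertonDyer.BirchSwinnertonDyer.Theorems.CartanSupply.CubicClasses

open Summit.BirchSwinnertonDyer.BirchSwinnertonDyer.Theorems.CartanDegree
open Summit.BirchSwinnertonDyer.BirchSwinnertonDyer.Theorems.CartanTorusCubeCut

set_option linter.dupNamespace false
set_option autoImplicit false

open scoped Classical

variable {q : ℕ} [Fact q.Prime]

/-! ## §1 Cubes, non-zero vectors, the cubic classes -/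

/-- The subgroup `K` of cubes in `𝔽_q^×`. -/
def cubes (q : ℕ) [Fact q.Prime] : Subgroup (ZMod q)ˣ := (powMonoidHom 3 : (ZMod q)ˣ →* (ZMod q)ˣ).range

/-- PROVED: membership in `K`. [folklore] -/
theorem mem_cubes_iff (u : (ZMod q)ˣ) : u ∈ cubes q ↔ ∃ w : (ZMod q)ˣ, w ^ 3 = u := by
  simp [cubes, MonoidHom.mem_range]

/-- PROVED: membership in `K`, field version. [folklore] -/
theorem mem_cubes_iff_val (u : (ZMod q)ˣ) : u ∈ cubes q ↔ ∃ w : ZMod q, w ^ 3 = (u : ZMod q) := by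
  rw [mem_cubes_iff]
  constructor
  · rintro ⟨w, hw⟩
    exact ⟨w, by rw [← hw, Units.val_pow_eq_pow_val]⟩
  · rintro ⟨w, hw⟩
    have hw0 : w ≠ 0 := by rintro rfl; exact u.ne_zero (by rw [← hw]; ring)
    exact ⟨Units.mk0 w hw0, Units.ext (by rw [Units.val_pow_eq_pow_val, Units.val_mk0, hw])⟩

/-- The non-zero vectors of `𝔽_q²`. -/
abbrev V0 (q : ℕ) [Fact q.Prime] : Type := {v : Fin 2 → ZMod q // v ≠ 0}

/-- Unit scaling of a non-zero vector. -/
def scaleV (u : (ZMod q)ˣ) (v : V0 q) : V0 q := ⟨(u : ZMod q) • (v : Fin 2 → ZMod q), smul_ne_zero u.ne_zero v.2⟩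

/-- PROVED: unfolding. [folklore] -/
theorem coe_scaleV (u : (ZMod q)ˣ) (v : V0 q) : ((scaleV u v : V0 q) : Fin 2 → ZMod q) = (u : ZMod q) • (v : Fin 2 → ZMod q) := rfl

/-- PROVED: `1` scales trivially. [folklore] -/
theorem scaleV_one (v : V0 q) : scaleV 1 v = v := Subtype.ext (by simp [coe_scaleV])

/-- PROVED: scaling is an action. [folklore] -/
theorem scaleV_mul (u w : (ZMod q)ˣ) (v : V0 q) : scaleV (u * w) v = scaleV u (scaleV w v) :=
  Subtype.ext (by simp [coe_scaleV, mul_smul])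

/-- The cubic-class relation on `V₀`: `v ~ w` iff `v = k w` for a cube `k`. -/
def cubicSetoid (q : ℕ) [Fact q.Prime] : Setoid (V0 q) := (MulAction.orbitRel (cubes q) (Fin 2 → ZMod q)).comap Subtype.val

/-- The CUBIC CLASSES `X = V₀ ∕ K`. -/
def X (q : ℕ) [Fact q.Prime] : Type := Quotient (cubicSetoid q)

/-- `X` is finite (classical representatives). -/
noncomputable instance instFintypeX : Fintype (X q) :=
  @Quotient.fintype _ _ (cubicSetoid q) (fun _ _ => Classical.propDecidable _)

/-- The class of a non-zero vector. -/
def mk (v : V0 q) : X q := Quotient.mk (cubicSetoid q) v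

/-- PROVED: every class has a representative. [folklore] -/
theorem mk_surjective : Function.Surjective (mk : V0 q → X q) := by
  intro x; induction x using Quotient.ind with | _ v => exact ⟨v, rfl⟩

/-- PROVED: two vectors have the same class iff they differ by a cube. [folklore] -/
theorem mk_eq_mk_iff {v w : V0 q} : mk v = mk w ↔ ∃ k : (ZMod q)ˣ, k ∈ cubes q ∧ scaleV k w = v := by
  have key : (cubicSetoid q) v w ↔ ∃ k : (ZMod q)ˣ, k ∈ cubes q ∧ scaleV k w = v := by
    change (MulAction.orbitRel (cubes q) (Fin 2 → ZMod q)) (v : Fin 2 → ZMod q) (w : Fin 2 → ZMod q) ↔ _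
    rw [MulAction.orbitRel_apply, MulAction.mem_orbit_iff]
    exact ⟨fun ⟨⟨k, hk⟩, h⟩ => ⟨k, hk, Subtype.ext h⟩, fun ⟨k, hk, h⟩ => ⟨⟨k, hk⟩, congrArg Subtype.val h⟩⟩
  exact ⟨fun h => key.mp (Quotient.exact h), fun h => Quotient.sound (key.mpr h)⟩

/-- PROVED: scaling by a cube does not change the class. [folklore] -/
theorem mk_scaleV_of_mem {k : (ZMod q)ˣ} (hk : k ∈ cubes q) (v : V0 q) : mk (scaleV k v) = mk v :=
  mk_eq_mk_iff.mpr ⟨k, hk, rfl⟩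

/-! ## §2 Maps `V₀ → V₀` commuting with scalings descend to `X` -/

/-- A self-map of `V₀` commuting with all unit scalings, pushed down to `X`. -/
def descend (f : V0 q → V0 q) (hf : ∀ (u : (ZMod q)ˣ) (v : V0 q), f (scaleV u v) = scaleV u (f v)) : X q → X q :=
  Quotient.map' f (fun v w h => by
    have h' : mk v = mk w := Quotient.sound h
    obtain ⟨k, hk, hkw⟩ := mk_eq_mk_iff.mp h'
    exact Quotient.exact (mk_eq_mk_iff.mpr ⟨k, hk, by rw [← hkw, hf]⟩ : mk (f v) = mk (f w)))

/-- PROVED: unfolding. [folklore] -/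
theorem descend_mk (f : V0 q → V0 q) (hf : ∀ (u : (ZMod q)ˣ) (v : V0 q), f (scaleV u v) = scaleV u (f v)) (v : V0 q) :
    descend f hf (mk v) = mk (f v) := rfl

/-- A permutation of `V₀` commuting with all unit scalings, pushed down to a permutation of `X`. -/
def descendPerm (e : Equiv.Perm (V0 q)) (he : ∀ (u : (ZMod q)ˣ) (v : V0 q), e (scaleV u v) = scaleV u (e v)) : Equiv.Perm (X q) where
  toFun := descend e he
  invFun := descend e.symm (fun u v => by
    apply e.injective
    rw [he, Equiv.apply_symm_apply, Equiv.apply_symm_apply])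
  left_inv x := by
    obtain ⟨v, rfl⟩ := mk_surjective x
    rw [descend_mk, descend_mk, Equiv.symm_apply_apply]
  right_inv x := by
    obtain ⟨v, rfl⟩ := mk_surjective x
    rw [descend_mk, descend_mk, Equiv.apply_symm_apply]

/-- PROVED: unfolding. [folklore] -/
theorem descendPerm_mk (e : Equiv.Perm (V0 q)) (he : ∀ (u : (ZMod q)ˣ) (v : V0 q), e (scaleV u v) = scaleV u (e v)) (v : V0 q) :
    descendPerm e he (mk v) = mk (e v) := rfl

/-! ## §3 The twisted action `g ⋆ v = det g · g v` and its descent -/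

/-- PROVED: `det g ≠ 0`. [folklore] -/
theorem det_ne_zero (g : G q) : (g : Mat q).det ≠ 0 := by
  have := g.isUnit
  rw [Matrix.isUnit_iff_isUnit_det, isUnit_iff_ne_zero] at this
  exact this

/-- PROVED: `g v ≠ 0` for `v ≠ 0`. [folklore] -/
theorem mulVec_ne_zero (g : G q) {v : Fin 2 → ZMod q} (hv : v ≠ 0) : (g : Mat q).mulVec v ≠ 0 := by
  intro h
  apply hv
  have h2 := congrArg (((g⁻¹ : G q) : Mat q).mulVec) h
  rwa [Matrix.mulVec_mulVec, Matrix.mulVec_zero, ← Units.val_mul, inv_mul_cancel, Units.val_one, Matrix.one_mulVec] at h2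

/-- The twisted action on non-zero vectors: `g ⋆ v = det g · g v`. -/
def actV (g : G q) (v : V0 q) : V0 q :=
  ⟨(g : Mat q).det • (g : Mat q).mulVec v, smul_ne_zero (det_ne_zero g) (mulVec_ne_zero g v.2)⟩

/-- PROVED: unfolding. [folklore] -/
theorem coe_actV (g : G q) (v : V0 q) : ((actV g v : V0 q) : Fin 2 → ZMod q) = (g : Mat q).det • (g : Mat q).mulVec v := rfl

/-- PROVED: `1 ⋆ v = v`. [folklore] -/
theorem actV_one (v : V0 q) : actV 1 v = v := Subtype.ext (by simp [coe_actV])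

/-- PROVED: `(gh) ⋆ v = g ⋆ (h ⋆ v)`. [folklore] -/
theorem actV_mul (g h : G q) (v : V0 q) : actV (g * h) v = actV g (actV h v) := by
  apply Subtype.ext
  rw [coe_actV, coe_actV, coe_actV, Units.val_mul, Matrix.det_mul, ← Matrix.mulVec_mulVec, Matrix.mulVec_smul, smul_smul]

/-- PROVED: the twisted action commutes with unit scalings. [folklore] -/
theorem actV_scaleV (g : G q) (u : (ZMod q)ˣ) (v : V0 q) : actV g (scaleV u v) = scaleV u (actV g v) := by
  apply Subtype.ext
  rw [coe_actV, coe_scaleV, coe_scaleV, coe_actV, Matrix.mulVec_smul]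
  exact smul_comm _ _ _

/-- The twisted action as permutations of `V₀`. -/
def σV : G q →* Equiv.Perm (V0 q) where
  toFun g :=
    { toFun := actV g
      invFun := actV g⁻¹
      left_inv := fun v => by rw [← actV_mul, inv_mul_cancel, actV_one]
      right_inv := fun v => by rw [← actV_mul, mul_inv_cancel, actV_one] }
  map_one' := by ext v : 1; exact actV_one v
  map_mul' g h := by ext v : 1; exact actV_mul g h v

/-- PROVED: unfolding. [folklore] -/
theorem σV_apply (g : G q) (v : V0 q) : σV g v = actV g v := rfl

/-- The twisted action on the cubic classes. -/
def σX : G q →* Equiv.Perm (X q) where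
  toFun g := descendPerm (σV g) (fun u v => actV_scaleV g u v)
  map_one' := by
    ext x : 1
    obtain ⟨v, rfl⟩ := mk_surjective x
    rw [descendPerm_mk, map_one]; rfl
  map_mul' g h := by
    ext x : 1
    obtain ⟨v, rfl⟩ := mk_surjective x
    rw [Equiv.Perm.mul_apply, descendPerm_mk, descendPerm_mk, descendPerm_mk, map_mul]; rfl

/-- PROVED: `g ⋆ [v] = [g ⋆ v]`. [folklore] -/
theorem σX_mk (g : G q) (v : V0 q) : σX g (mk v) = mk (actV g v) := rfl

/-! ## §4 Unit scalings on `X` -/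

/-- The unit scaling `ρ_u [v] = [u v]` on `X`. -/
def ρX (u : (ZMod q)ˣ) : Equiv.Perm (X q) :=
  descendPerm
    { toFun := scaleV u, invFun := scaleV u⁻¹
      left_inv := fun v => by rw [← scaleV_mul, inv_mul_cancel, scaleV_one]
      right_inv := fun v => by rw [← scaleV_mul, mul_inv_cancel, scaleV_one] }
    (fun w v => by show scaleV u (scaleV w v) = scaleV w (scaleV u v); rw [← scaleV_mul, ← scaleV_mul, mul_comm])

/-- PROVED: `ρ_u [v] = [u v]`. [folklore] -/
theorem ρX_mk (u : (ZMod q)ˣ) (v : V0 q) : ρX u (mk v) = mk (scaleV u v) := rfl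

/-- PROVED: `ρ_1 = 1`. [folklore] -/
theorem ρX_one : ρX (1 : (ZMod q)ˣ) = 1 := by
  ext x : 1
  obtain ⟨v, rfl⟩ := mk_surjective x
  rw [ρX_mk, scaleV_one]; rfl

/-- PROVED: `ρ_{uw} = ρ_u ρ_w`. [folklore] -/
theorem ρX_mul (u w : (ZMod q)ˣ) : ρX (u * w) = ρX u * (ρX w : Equiv.Perm (X q)) := by
  ext x : 1
  obtain ⟨v, rfl⟩ := mk_surjective x
  rw [Equiv.Perm.mul_apply, ρX_mk, ρX_mk, ρX_mk, scaleV_mul]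

/-- PROVED: cubes scale trivially on `X`. [folklore] -/
theorem ρX_of_mem {k : (ZMod q)ˣ} (hk : k ∈ cubes q) : ρX k = (1 : Equiv.Perm (X q)) := by
  ext x : 1
  obtain ⟨v, rfl⟩ := mk_surjective x
  rw [ρX_mk, mk_scaleV_of_mem hk]; rfl

/-- PROVED: `ρ_u³ = 1`. [folklore] -/
theorem ρX_pow_three (u : (ZMod q)ˣ) : ρX u ^ 3 = (1 : Equiv.Perm (X q)) := by
  rw [pow_three, ← ρX_mul, ← ρX_mul, ρX_of_mem]
  rw [mem_cubes_iff]; exact ⟨u, by rw [pow_three]⟩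

/-- PROVED: the scalings commute with the twisted action. [folklore] -/
theorem σX_ρX_comm (g : G q) (u : (ZMod q)ˣ) : σX g * ρX u = ρX u * (σX g : Equiv.Perm (X q)) := by
  ext x : 1
  obtain ⟨v, rfl⟩ := mk_surjective x
  rw [Equiv.Perm.mul_apply, Equiv.Perm.mul_apply, ρX_mk, σX_mk, σX_mk, ρX_mk, actV_scaleV]

/-- PROVED: a non-cube scaling has no fixed point on `X`. [folklore] -/
theorem ρX_ne_self {u : (ZMod q)ˣ} (hu : u ∉ cubes q) (x : X q) : ρX u x ≠ x := by
  obtain ⟨v, rfl⟩ := mk_surjective x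
  rw [ρX_mk, Ne, mk_eq_mk_iff]
  rintro ⟨k, hk, h⟩
  apply hu
  -- `k v = u v` with `v ≠ 0` forces `k = u`
  have h' : ((k : ZMod q) - u) • (v : Fin 2 → ZMod q) = 0 := by
    rw [sub_smul, ← coe_scaleV, ← coe_scaleV, h, sub_self]
  rcases smul_eq_zero.mp h' with h0 | h0
  · have : k = u := Units.ext (sub_eq_zero.mp h0)
    rw [← this]; exact hk
  · exact absurd h0 v.2

/-! ## §5 The projection to `ℙ¹(𝔽_q)` -/

/-- The projection `[v]_K ↦ [v]` to the projective line. -/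
def toP1 : X q → Steinberg.P1 q :=
  Quotient.lift (fun v : V0 q => Projectivization.mk (ZMod q) (v : Fin 2 → ZMod q) v.2) (fun v w h => by
    have h' : mk v = mk w := Quotient.sound h
    obtain ⟨k, hk, hkw⟩ := mk_eq_mk_iff.mp h'
    rw [Projectivization.mk_eq_mk_iff]
    exact ⟨k, by rw [← hkw]; rfl⟩)

/-- PROVED: unfolding. [folklore] -/
theorem toP1_mk (v : V0 q) : toP1 (mk v) = Projectivization.mk (ZMod q) (v : Fin 2 → ZMod q) v.2 := rfl

/-- PROVED: `toP1` is surjective. [folklore] -/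
theorem toP1_surjective : Function.Surjective (toP1 : X q → Steinberg.P1 q) := by
  intro p; induction p using Projectivization.ind with | h v hv => exact ⟨mk ⟨v, hv⟩, rfl⟩

/-- PROVED: `toP1` is equivariant (the scalar `det g` is invisible on `ℙ¹`). [folklore] -/
theorem toP1_σX (g : G q) (x : X q) : toP1 (σX g x) = g • toP1 x := by
  obtain ⟨v, rfl⟩ := mk_surjective x
  rw [σX_mk, toP1_mk, toP1_mk, Steinberg.smul_mk_eq, Projectivization.mk_eq_mk_iff]
  exact ⟨Units.mk0 _ (det_ne_zero g), by rw [coe_actV]; rfl⟩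

/-- PROVED: `toP1` is invariant under the scalings. [folklore] -/
theorem toP1_ρX (u : (ZMod q)ˣ) (x : X q) : toP1 (ρX u x) = toP1 x := by
  obtain ⟨v, rfl⟩ := mk_surjective x
  rw [ρX_mk, toP1_mk, toP1_mk, Projectivization.mk_eq_mk_iff]
  exact ⟨u, rfl⟩

/-- PROVED: the fibres of `toP1` are the scaling orbits. [folklore] -/
theorem toP1_eq_toP1_iff (x y : X q) : toP1 y = toP1 x ↔ ∃ u : (ZMod q)ˣ, y = ρX u x := by
  constructor
  · obtain ⟨v, rfl⟩ := mk_surjective x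
    obtain ⟨w, rfl⟩ := mk_surjective y
    rw [toP1_mk, toP1_mk, Projectivization.mk_eq_mk_iff]
    rintro ⟨u, hu⟩
    refine ⟨u, ?_⟩
    rw [ρX_mk]
    congr 1
    apply Subtype.ext
    rw [coe_scaleV, ← hu]
    rfl
  · rintro ⟨u, rfl⟩
    exact toP1_ρX u x

/-! ## §6 Fixed points of `g` on `X` and the count `#Fix(g | X) · #K = E(g)` -/

/-- PROVED: `g ⋆ [v] = [v] ⟺ v` is an eigenvector of `g` whose eigenvalue `a` has `a²/det g` a cube. [folklore] -/
theorem σX_mk_eq_mk_iff (g : G q) (v : V0 q) :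
    σX g (mk v) = mk v ↔ ∃ a : ZMod q, (g : Mat q).mulVec v = a • (v : Fin 2 → ZMod q) ∧ ∃ u : ZMod q, u ^ 3 * (g : Mat q).det = a ^ 2 := by
  rw [σX_mk, mk_eq_mk_iff]
  have hd := det_ne_zero g
  constructor
  · rintro ⟨k, hk, h⟩
    have h' := congrArg Subtype.val h
    rw [coe_scaleV, coe_actV] at h'
    -- `k v = d · g v` ⇒ `g v = (k/d) v`
    obtain ⟨w, hw⟩ := (mem_cubes_iff_val k).mp hk
    refine ⟨(k : ZMod q) * ((g : Mat q).det)⁻¹, ?_, ?_⟩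
    · have := congrArg (fun z => ((g : Mat q).det)⁻¹ • z) h'
      simp only [smul_smul, inv_mul_cancel₀ hd, one_smul] at this
      rw [← this, mul_comm]
    · -- `u³ d = k²/d²` with `u = w²/d`... : `(w²/d)³ · d = w⁶/d² = k²/d²`
      refine ⟨w ^ 2 * ((g : Mat q).det)⁻¹, ?_⟩
      rw [mul_pow, ← pow_mul, show 2 * 3 = 3 * 2 by norm_num, pow_mul, hw]
      field_simp
  · rintro ⟨a, ha, u, hu⟩
    have ha0 : a ≠ 0 := by
      rintro rfl
      rw [zero_smul] at ha
      exact (mulVec_ne_zero g v.2) ha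
    -- `k = a d` is a cube: `a d = a³ d / a² = a³ d /(u³ d) = (a/u)³`
    have hu0 : u ≠ 0 := by
      rintro rfl
      apply ha0
      have : a ^ 2 = 0 := by rw [← hu]; ring
      exact pow_eq_zero_iff (n := 2) (by norm_num) |>.mp this
    refine ⟨Units.mk0 (a * (g : Mat q).det) (mul_ne_zero ha0 hd), ?_, ?_⟩
    · rw [mem_cubes_iff_val, Units.val_mk0]
      refine ⟨a * u⁻¹, ?_⟩
      have hu3 : u ^ 3 ≠ 0 := pow_ne_zero 3 hu0
      apply mul_right_cancel₀ hu3
      calc (a * u⁻¹) ^ 3 * u ^ 3 = a ^ 3 * (u⁻¹ * u) ^ 3 := by ring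
        _ = a ^ 3 := by rw [inv_mul_cancel₀ hu0, one_pow, mul_one]
        _ = a * (g : Mat q).det * u ^ 3 := by linear_combination (-a) * hu
    · apply Subtype.ext
      rw [coe_scaleV, coe_actV, Units.val_mk0, ha, smul_smul, mul_comm]

/-- PROVED: every class has exactly `#K` members. [folklore] -/
theorem card_fibre_mk (x : X q) : (Finset.univ.filter fun v : V0 q => mk v = x).card = Nat.card (cubes q) := by
  obtain ⟨v, rfl⟩ := mk_surjective x
  rw [Nat.card_eq_fintype_card, ← Finset.card_univ]
  symm
  refine Finset.card_bij (fun k _ => scaleV (k : (ZMod q)ˣ) v) (fun k _ => ?_) (fun k _ k' _ h => ?_) (fun w hw => ?_)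
  · simp only [Finset.mem_filter, Finset.mem_univ, true_and]
    exact mk_scaleV_of_mem k.2 v
  · -- free action: `k v = k' v ⇒ k = k'`
    have h' := congrArg Subtype.val h
    rw [coe_scaleV, coe_scaleV] at h'
    have h'' : (((k : (ZMod q)ˣ) : ZMod q) - ((k' : (ZMod q)ˣ) : ZMod q)) • (v : Fin 2 → ZMod q) = 0 := by
      rw [sub_smul, h', sub_self]
    rcases smul_eq_zero.mp h'' with h0 | h0
    · exact Subtype.ext (Units.ext (sub_eq_zero.mp h0))
    · exact absurd h0 v.2
  · simp only [Finset.mem_filter, Finset.mem_univ, true_and] at hw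
    obtain ⟨k, hk, hkv⟩ := mk_eq_mk_iff.mp hw
    exact ⟨⟨k, hk⟩, Finset.mem_univ _, hkv⟩

/-- PROVED: a `K`-saturated count on `V₀` is `#K` times the count on `X`. [folklore] -/
theorem card_filter_V0_eq (P : X q → Prop) :
    (Finset.univ.filter fun v : V0 q => P (mk v)).card = Nat.card (cubes q) * (Finset.univ.filter fun x : X q => P x).card := by
  rw [Finset.card_eq_sum_card_fiberwise (f := fun v : V0 q => mk v) (t := Finset.univ.filter fun x : X q => P x)]
  · have : ∀ x ∈ Finset.univ.filter (fun x : X q => P x),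
        ((Finset.univ.filter fun v : V0 q => P (mk v)).filter fun v => mk v = x).card = Nat.card (cubes q) := by
      intro x hx
      simp only [Finset.mem_filter, Finset.mem_univ, true_and] at hx
      rw [← card_fibre_mk x]
      congr 1
      ext v
      simp only [Finset.mem_filter, Finset.mem_univ, true_and]
      constructor
      · exact fun h => h.2
      · intro h; exact ⟨h ▸ hx, h⟩
    rw [Finset.sum_congr rfl this, Finset.sum_const, smul_eq_mul, mul_comm]
  · intro v hv
    simp only [Finset.coe_filter, Finset.mem_univ, true_and, Set.mem_setOf_eq] at hv ⊢
    exact hv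

/-- PROVED: the non-zero-vector count equals the count over `V₀`. [folklore] -/
theorem card_filter_ne_zero_eq (P : (Fin 2 → ZMod q) → Prop) :
    (Finset.univ.filter fun v : Fin 2 → ZMod q => v ≠ 0 ∧ P v).card = (Finset.univ.filter fun v : V0 q => P v).card := by
  refine Finset.card_bij (fun v hv => ⟨v, (Finset.mem_filter.mp hv).2.1⟩) (fun v hv => ?_) (fun v _ w _ h => ?_) (fun w hw => ?_)
  · simp only [Finset.mem_filter, Finset.mem_univ, true_and] at hv ⊢
    exact hv.2
  · exact congrArg Subtype.val h
  · simp only [Finset.mem_filter, Finset.mem_univ, true_and] at hw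
    exact ⟨w, by simp [w.2, hw], rfl⟩

/-- PROVED — **`#Fix(g | X) · #K = E(g)`**, `E(g) = #{v ≠ 0 : g v = a v, ∃ u, u³ det g = a²}` the count of `…CubicPointsFixed*`. [folklore] -/
theorem card_fixed_mul_card_cubes (g : G q) :
    Nat.card (cubes q) * (Finset.univ.filter fun x : X q => σX g x = x).card =
      (Finset.univ.filter fun v : Fin 2 → ZMod q => v ≠ 0 ∧
        ∃ a : ZMod q, (g : Mat q).mulVec v = a • v ∧ ∃ u : ZMod q, u ^ 3 * (g : Mat q).det = a ^ 2).card := by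
  rw [← card_filter_V0_eq (fun x => σX g x = x)]
  have h1 : (Finset.univ.filter fun v : V0 q => σX g (mk v) = mk v) =
      Finset.univ.filter fun v : V0 q =>
        ∃ a : ZMod q, (g : Mat q).mulVec v = a • (v : Fin 2 → ZMod q) ∧ ∃ u : ZMod q, u ^ 3 * (g : Mat q).det = a ^ 2 :=
    Finset.filter_congr (fun v _ => σX_mk_eq_mk_iff g v)
  rw [h1]
  convert (card_filter_ne_zero_eq (q := q)
    (fun v => ∃ a : ZMod q, (g : Mat q).mulVec v = a • v ∧ ∃ u : ZMod q, u ^ 3 * (g : Mat q).det = a ^ 2)).symm using 3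

end Summit.BirchSwinnertonDyer.BirchSwinnertonDyer.Theorems.CartanSupply.CubicClasses
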